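import Summits.HodgeConjecture.HodgeConjecture.Theorems.SeparatedCyclotomicSelfMapSquareHodge
import Summits.HodgeConjecture.HodgeConjecture.Theorems.FermatSurfaceExoticPairsDefs
import Summits.HodgeConjecture.HodgeConjecture.Theorems.PadicSemiregularLiftHodgeFermatVarietiesExistsFibreOfNotPairedPow
import Summits.HodgeConjecture.HodgeConjecture.Theorems.PadicSemiregularLiftHodgeFermatVarietiesSigmaStdOfFibre
import Summits.HodgeConjecture.HodgeConjecture.Theorems.PadicSemiregularLiftHodgeFermatVarietiesCoprimeSixPayoff
import Summits.HodgeConjecture.FermatCycles.AokiTheoremA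

/-!
# Exotic Hodge pairs on Fermat squares, I — pair-free transcendental quadruples and the separation CRITERION `𝔅⁶ₘ = 𝔇⁶ₘ ⇒ FermatSep m`

Part 1 of 4 (Sketch §0, ll. 48–313). Over the dictionary of `Theorems/FermatSurfaceExoticPairsDefs` (`IsTransQuad`, `negM`,
`IsHodgePair`, `FermatSep`, `FermatSepCriterion`; all statements about Shioda's semigroup `IsHodgeMultiset`):
* the `negM` bookkeeping (`count_negM`, `negM_negM`, `card_negM`, `sum_negM`, `mem_negM`, `isHodgeMultiset_negM(_iff)`, `isTransQuad_negM`);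
* transcendental quadruples are PAIR-FREE (`IsTransQuad_ne_pair_add`, `IsTransQuad_neg_not_mem`, `IsTransQuad_count_le_one`);
* `IsPairSymmetric` multisets and the separation theorem `fermatSep_of_pairSymmetric_octuples`: if every Hodge OCTUPLE of degree `m`
  (Hodge character of the Fermat sixfold `X⁶ₘ`) is pair-symmetric then `X²ₘ` has no exotic Hodge pairs;
* Aoki's standard elements `IsStandard` (`𝔇`), `isPairSymmetric_of_isStandard` ∕ `isStandard_of_isPairSymmetric`, the property
  `HodgeOctuplesStandard m` (`𝔅⁶ₘ ⊆ 𝔇⁶ₘ`) and **`fermatSep_of_hodgeOctuplesStandard : HodgeOctuplesStandard m → FermatSep m`**;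
* the hypothesis shape `AokiThmASix m` (Aoki 1983 Thm A (ii) at `n = 6`) and `fermatSep_of_aokiThmASix` (it is DISCHARGED as a theorem
  in Part 3, `aokiThmASix_holds`, from cell pub-hfermat's kernel `FermatCycles.AokiTheoremA.theoremA`).

PROVENANCE. Cell hodge-nonav (HUMAN RULING D-0038), planner seat p1: chapters ROUTE-P1AE §B (g32) and ROUTE-P1AF + ADD (g33),
frozen Sketch `HOME/p1/route/Sketch_P1AF_ADD_SEPLAW_g33.lean` (sha16 9c70bd8d356ffb70, 1004 lines, namespace `HodgeNonAV.P1AF`,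
farm rc 0 / 0 sorries / axioms {propext, Classical.choice, Quot.sound}; referee PASS: REF-P1AF b32cd9c28a7cc495), split into
four tree modules `FermatSurfaceSeparationCriterion` → `…Sigma` → `…Closures` → `FermatSurfaceSeparationLaw` by planner p1 g34
(landing kit HOME/p1/landing/, 2026-08-28); bodies verbatim, namespace moved to that of `Theorems/FermatSurfaceExoticPairsDefs`.
Land with `--supports stmt-HodgeConjecture-19652 --as helper` (K6 ∕ evidence carrier of the non-AV index) or `--supports
stmt-HodgeConjecture-1334` (the Fermat line whose engines §2 consumes). No instance, no notation, no sorry, no new axiom.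
HONEST SCOPE: combinatorics of Shioda's Hodge-character semigroup of Fermat surfaces and sixfolds; NOTHING here proves the
Hodge conjecture or HC for any new variety — `FermatSep m` is the INPUT half of `HC⁴(X²ₘ × X²ₘ)` via the landed SQ-AUT theorem
`PgOneCyclotomicSquares.hodgeConjectureFor_square_of_endomorphisms`, and those squares are dominated by Fermat/abelian motives anyway.
References: N. Aoki, Math. Ann. 266 (1983) Thm A, §1 (𝔇ⁿₘ), §5 Thm D, Prop. 6.4/6.6, Lemma 7.3 [cite: Aoki1983, Thm. A];
N. Aoki, J. Math. Soc. Japan 39 (1987) Thm 2-1 [cite: Aoki1987, Thm. 2-1]; N. Aoki, Comment. Math. Univ. St. Pauli 49 (2000) Lemma 4.1;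
T. Shioda, Math. Ann. 245 (1979) Thm I–IV [cite: Shioda1979PJA, Thm. I]; Z. Ran, Compositio Math. 42 (1980) Prop. 1.8 [cite: Ran1980, Prop. 1.8];
G. da Silva Jr., arXiv:2101.04739 (2021) Thm 2.1–2.2, Prop. 3.1 [cite: daSilva2021HodgeFermat, Thm. 2.1].
-/

set_option linter.dupNamespace false

noncomputable section

namespace Summit.HodgeConjecture.HodgeConjecture.Theorems.FermatSurfaceExoticPairs

open Multiset Literature.AlgebraicGeometry.HodgeTheory.FermatCharacter

variable {m : ℕ}

/-! ## §0  Inherited from ROUTE-P1AE §B (g32; verbatim) -/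


/-! ### negation bookkeeping (local copies of the `negM` API; tree versions ride with `Theorems/FermatSurfaceExoticPairs`) -/

/-- `#{y ∈ -w} = #{-y ∈ w}`. [folklore] -/
theorem count_negM (w : Multiset (ZMod m)) (y : ZMod m) : count y (negM w) = count (-y) w := by
  have h := count_map_eq_count' (fun a : ZMod m ↦ -a) w neg_injective (-y)
  simpa [negM] using h

/-- `-(-w) = w`. [folklore] -/
theorem negM_negM (w : Multiset (ZMod m)) : negM (negM w) = w := by
  simp [negM, Multiset.map_map]

/-- `#(-w) = #w`. [folklore] -/
theorem card_negM (w : Multiset (ZMod m)) : card (negM w) = card w := by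
  simp [negM]

/-- `∑(-w) = -∑ w`. [folklore] -/
theorem sum_negM (w : Multiset (ZMod m)) : (negM w).sum = -w.sum := by
  induction w using Multiset.induction_on with
  | empty => simp [negM]
  | cons a s ih =>
    simp only [negM, Multiset.map_cons, Multiset.sum_cons] at ih ⊢
    rw [ih, neg_add]

/-- `a ∈ -w ↔ -a ∈ w`. [folklore] -/
theorem mem_negM {w : Multiset (ZMod m)} {a : ZMod m} : a ∈ negM w ↔ -a ∈ w := by
  constructor
  · intro h
    obtain ⟨b, hb, rfl⟩ := Multiset.mem_map.1 h
    rwa [neg_neg]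
  · intro h
    exact Multiset.mem_map.2 ⟨-a, h, neg_neg a⟩

/-- Negation preserves Hodge multisets (`⟨-ta⟩ = ⟨(-t)a⟩`, `-t` a unit). [cite: Shioda1979PJA, §1] -/
theorem isHodgeMultiset_negM {s : Multiset (ZMod m)} (h : IsHodgeMultiset s) : IsHodgeMultiset (negM s) := by
  refine ⟨⟨fun a ha ↦ ?_, ?_⟩, fun t ↦ ?_⟩
  · rw [mem_negM] at ha
    intro h0
    exact h.1.1 (-a) ha (by rw [h0, neg_zero])
  · rw [sum_negM, h.1.2, neg_zero]
  · have ht := h.2 (-t)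
    rw [card_negM]
    have hmap : (negM s).map (fun b ↦ (t : ZMod m) * b) = s.map fun b ↦ ((-t : (ZMod m)ˣ) : ZMod m) * b := by
      rw [negM, Multiset.map_map]
      refine Multiset.map_congr rfl fun b _ ↦ ?_
      simp [Units.val_neg, mul_neg, neg_mul]
    rw [hmap, ht]

/-- … and reflects them. [cite: Shioda1979PJA, §1] -/
theorem isHodgeMultiset_negM_iff {s : Multiset (ZMod m)} : IsHodgeMultiset (negM s) ↔ IsHodgeMultiset s :=
  ⟨fun h ↦ by simpa only [negM_negM] using isHodgeMultiset_negM h, isHodgeMultiset_negM⟩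

/-- Negation preserves transcendental quadruples. [cite: Shioda1979PJA, §1] -/
theorem isTransQuad_negM {u : Multiset (ZMod m)} (hu : IsTransQuad u) : IsTransQuad (negM u) := by
  obtain ⟨hc, hz, hs, hn⟩ := hu
  refine ⟨by rw [card_negM, hc], fun a ha ↦ ?_, by rw [sum_negM, hs, neg_zero], fun h ↦ hn ?_⟩
  · rw [mem_negM] at ha
    intro h0
    exact hz (-a) ha (by rw [h0, neg_zero])
  · exact isHodgeMultiset_negM_iff.1 h

/-! ### transcendental quadruples are pair-free -/

/-- **A transcendental quadruple contains no pair `{a, -a}`**: otherwise `u = {a, -a, b, -b}` (the complement has two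
elements with zero sum) would be a Hodge multiset. [cite: Shioda1979PJA, §1–2 (elements of length 1 generate for primes)] -/
theorem IsTransQuad_ne_pair_add [NeZero m] {u : Multiset (ZMod m)} (hu : IsTransQuad u) (a : ZMod m)
    (t : Multiset (ZMod m)) : u ≠ {a, -a} + t := by
  rintro rfl
  obtain ⟨hc, hz, hs, hn⟩ := hu
  have ha : a ≠ 0 := hz a (Multiset.mem_add.2 (Or.inl (by simp)))
  have hct : card t = 2 := by
    rw [Multiset.card_add, Multiset.insert_eq_cons, Multiset.card_cons, Multiset.card_singleton] at hc
    omega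
  obtain ⟨b, c, rfl⟩ := Multiset.card_eq_two.1 hct
  have hsum : a + -a + (b + c) = 0 := by
    rw [Multiset.sum_add, Multiset.insert_eq_cons, Multiset.sum_cons, Multiset.sum_singleton,
      Multiset.insert_eq_cons, Multiset.sum_cons, Multiset.sum_singleton] at hs
    rw [← add_assoc] at hs ⊢
    simpa [add_assoc] using hs
  have hbc : b + c = 0 := by rwa [add_neg_cancel, zero_add] at hsum
  have hb : b ≠ 0 := hz b (Multiset.mem_add.2 (Or.inr (by simp)))
  have hcb : c = -b := eq_neg_of_add_eq_zero_right hbc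
  subst hcb
  exact hn ((IsHodgeMultiset.pair ha).add (IsHodgeMultiset.pair hb))

/-- A transcendental quadruple containing `a ≠ -a` does not contain `-a`. [cite: Shioda1979PJA, §1] -/
theorem IsTransQuad_neg_not_mem [NeZero m] {u : Multiset (ZMod m)} (hu : IsTransQuad u) {a : ZMod m}
    (ha : a ∈ u) (hna : a ≠ -a) : -a ∉ u := by
  intro h
  obtain ⟨t, ht⟩ := exists_eq_pair_add ha (by rw [if_neg hna]; exact h)
  exact IsTransQuad_ne_pair_add hu a t ht

/-- A self-negative value (`2a = 0`) occurs at most once in a transcendental quadruple. [cite: Shioda1979PJA, §1] -/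
theorem IsTransQuad_count_le_one [NeZero m] {u : Multiset (ZMod m)} (hu : IsTransQuad u) {a : ZMod m}
    (hna : a = -a) : count a u ≤ 1 := by
  by_contra h
  have h2 : 2 ≤ count a u := by omega
  have ha : a ∈ u := Multiset.count_pos.1 (by omega)
  obtain ⟨t, ht⟩ := exists_eq_pair_add ha (by rw [if_pos hna]; exact h2)
  exact IsTransQuad_ne_pair_add hu a t ht

/-! ### pair-symmetric multisets and the separation theorem -/

/-- `s` is PAIR-SYMMETRIC: every value occurs as often as its negative, and a self-negative value an even number of
times — the multiplicity form of "`s` is a union of pairs `{a,-a}`" (Aoki's standard set `𝔇`, `IsStandard` below; the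
hypotheses of the tree's `IsHodgeMultiset.exists_eq_pair_add_of_count`). [cite: Aoki1983, §1 (𝔇ⁿₘ)] -/
def IsPairSymmetric (s : Multiset (ZMod m)) : Prop :=
  (∀ x, count (-x) s = count x s) ∧ ∀ a ∈ s, a = -a → Even (count a s)

/-- **Core lemma.** If `u, v` are transcendental quadruples and `u + v` is pair-symmetric, then `v = -u`:
pair-freeness of `u` and `v` pins every multiplicity. [cell hodge-nonav memo ROUTE-P1AE §B] -/
theorem eq_negM_of_isPairSymmetric_add [NeZero m] {u v : Multiset (ZMod m)} (hu : IsTransQuad u)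
    (hv : IsTransQuad v) (h : IsPairSymmetric (u + v)) : v = negM u := by
  obtain ⟨hsym, heven⟩ := h
  ext y
  rw [count_negM]
  have hs := hsym y
  rw [Multiset.count_add, Multiset.count_add] at hs
  by_cases hy : y = -y
  · -- a self-negative value: both multiplicities are `≤ 1` and their sum is even
    rw [← hy]
    have hu1 := IsTransQuad_count_le_one hu hy
    have hv1 := IsTransQuad_count_le_one hv hy
    by_cases hmem : y ∈ u + v
    · obtain ⟨k, hk⟩ := heven y hmem hy
      rw [Multiset.count_add] at hk
      omega
    · rw [Multiset.mem_add, not_or] at hmem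
      rw [Multiset.count_eq_zero.2 hmem.1, Multiset.count_eq_zero.2 hmem.2]
  · have hny : -y ≠ -(-y) := by rwa [neg_neg, ne_comm]
    by_cases hyu : -y ∈ u
    · have hyu' : y ∉ u := by
        have h' := IsTransQuad_neg_not_mem hu hyu hny
        rwa [neg_neg] at h'
      rw [Multiset.count_eq_zero.2 hyu', zero_add] at hs
      have hyv : y ∈ v := Multiset.count_pos.1 (by have := Multiset.count_pos.2 hyu; omega)
      have hnyv : -y ∉ v := IsTransQuad_neg_not_mem hv hyv hy
      rw [Multiset.count_eq_zero.2 hnyv, add_zero] at hs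
      exact hs.symm
    · rw [Multiset.count_eq_zero.2 hyu]
      by_contra hyv
      have hyv' : y ∈ v := Multiset.count_pos.1 (Nat.pos_of_ne_zero hyv)
      have hnyv : -y ∉ v := IsTransQuad_neg_not_mem hv hyv' hy
      rw [Multiset.count_eq_zero.2 hyu, Multiset.count_eq_zero.2 hnyv] at hs
      omega

/-- **KERNEL — FERMAT-SEP from pair-symmetric Hodge octuples.** If every Hodge multiset of degree `m` with `8`
elements is pair-symmetric, then `X²ₘ` has no exotic Hodge pairs: for a Hodge pair `(u, w)` the octuple `u + (-w)` is
pair-symmetric, so `-w = -u`. [cell hodge-nonav memo ROUTE-P1AE §B] [cite: Aoki1983, Thm. A] -/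
theorem fermatSep_of_pairSymmetric_octuples [NeZero m]
    (h : ∀ s : Multiset (ZMod m), IsHodgeMultiset s → card s = 8 → IsPairSymmetric s) : FermatSep m := by
  rintro u w ⟨hu, hw, hs⟩
  have hcard : card (u + negM w) = 8 := by rw [Multiset.card_add, card_negM, hu.1, hw.1]
  have key := eq_negM_of_isPairSymmetric_add hu (isTransQuad_negM hw) (h _ hs hcard)
  have h' := congrArg negM key
  rw [negM_negM, negM_negM] at h'
  exact h'.symm

/-! ### Aoki's standard elements `𝔇` -/

/-- `s ∈ 𝔇`: `s` is a union of pairs `{a, -a}` (Aoki's STANDARD elements of the character set; for a Hodge multiset the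
entries are automatically non-zero). [cite: Aoki1983, §1 (definition of 𝔇ⁿₘ)] -/
def IsStandard (s : Multiset (ZMod m)) : Prop :=
  ∃ l : Multiset (ZMod m), s = l.bind fun a ↦ ({a, -a} : Multiset (ZMod m))

/-- The pair `{a, -a}` is negation-symmetric in multiplicities. [folklore] -/
theorem count_neg_pair (a x : ZMod m) :
    count (-x) ({a, -a} : Multiset (ZMod m)) = count x ({a, -a} : Multiset (ZMod m)) := by
  simp only [Multiset.insert_eq_cons, Multiset.count_cons, Multiset.count_singleton, neg_inj]
  by_cases h1 : x = a
  · subst h1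
    by_cases h2 : -x = x
    · simp [h2]
    · rw [if_neg h2, if_neg (Ne.symm h2)]
      simp
  · have h2 : -x ≠ -a := fun h ↦ h1 (neg_injective h)
    rw [if_neg h1]
    by_cases h3 : -x = a
    · have h4 : x = -a := by rw [← h3, neg_neg]
      simp [h4]
    · have h4 : x ≠ -a := fun h ↦ h3 (by rw [h, neg_neg])
      simp [h3, h4]

/-- A self-negative value occurs an even number of times (`0` or `2`) in a pair `{a, -a}`. [folklore] -/
theorem even_count_pair_of_eq_neg (a : ZMod m) {b : ZMod m} (hb : b = -b) :
    Even (count b ({a, -a} : Multiset (ZMod m))) := by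
  simp only [Multiset.insert_eq_cons, Multiset.count_cons, Multiset.count_singleton]
  by_cases h1 : b = a
  · subst h1
    rw [if_pos rfl, if_pos hb]
    exact ⟨1, rfl⟩
  · have h2 : b ≠ -a := fun h ↦ h1 (by rw [hb, h, neg_neg])
    rw [if_neg h1, if_neg h2]
    exact ⟨0, rfl⟩

/-- Standard ⇒ pair-symmetric. [cite: Aoki1983, §1] -/
theorem isPairSymmetric_of_isStandard {s : Multiset (ZMod m)} (h : IsStandard s) : IsPairSymmetric s := by
  obtain ⟨l, rfl⟩ := h
  induction l using Multiset.induction_on with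
  | empty => exact ⟨fun x ↦ by simp, fun a ha _ ↦ by simp at ha⟩
  | cons a l ih =>
    obtain ⟨hsym, heven⟩ := ih
    refine ⟨fun x ↦ ?_, fun b hb hbn ↦ ?_⟩
    · rw [Multiset.cons_bind, Multiset.count_add, Multiset.count_add, hsym x, count_neg_pair]
    · rw [Multiset.cons_bind, Multiset.count_add]
      by_cases hbl : b ∈ l.bind fun a ↦ ({a, -a} : Multiset (ZMod m))
      · exact (even_count_pair_of_eq_neg a hbn).add (heven b hbl hbn)
      · rw [Multiset.count_eq_zero.2 hbl, add_zero]
        exact even_count_pair_of_eq_neg a hbn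

/-- Conversely a pair-symmetric HODGE multiset is standard (split off pairs with the tree's
`IsHodgeMultiset.exists_eq_pair_add_of_count`). [cite: Aoki1983, §1] [cite: Shioda1979PJA, §1] -/
theorem isStandard_of_isPairSymmetric [NeZero m] :
    ∀ s : Multiset (ZMod m), IsHodgeMultiset s → IsPairSymmetric s → IsStandard s := by
  suffices hk : ∀ k, ∀ s : Multiset (ZMod m), card s = k → IsHodgeMultiset s → IsPairSymmetric s → IsStandard s from
    fun s hs hp ↦ hk _ s rfl hs hp
  intro k
  induction k using Nat.strong_induction_on with
  | _ k ih =>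
    intro s hk hs hp
    by_cases hs0 : s = 0
    · exact ⟨0, by rw [hs0, Multiset.zero_bind]⟩
    · obtain ⟨a, t, _, ht, rfl⟩ := hs.exists_eq_pair_add_of_count hs0 hp.1 hp.2
      have hcard : card t < k := by
        rw [← hk, Multiset.card_add, Multiset.insert_eq_cons, Multiset.card_cons, Multiset.card_singleton]
        omega
      have hpt : IsPairSymmetric t := by
        obtain ⟨hsym, heven⟩ := hp
        refine ⟨fun x ↦ ?_, fun b hb hbn ↦ ?_⟩
        · have h := hsym x
          rw [Multiset.count_add, Multiset.count_add, count_neg_pair] at h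
          omega
        · have h := heven b (Multiset.mem_add.2 (Or.inr hb)) hbn
          rw [Multiset.count_add] at h
          obtain ⟨j, hj⟩ := even_count_pair_of_eq_neg a hbn
          obtain ⟨i, hi⟩ := h
          exact ⟨i - j, by omega⟩
      obtain ⟨l, hl⟩ := ih _ hcard t rfl ht hpt
      exact ⟨a ::ₘ l, by rw [Multiset.cons_bind, hl]⟩

/-- **`𝔅⁶ₘ ⊆ 𝔇⁶ₘ`** as a property of `m`: every Hodge octuple (Hodge class character of the Fermat SIXFOLD `X⁶ₘ`,
up to coordinate permutation) is standard. By Aoki 1983 Thm A this holds iff `m` is prime, `m = 4`, or every prime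
factor of `m` is `> 8`; the failure for other `m` is witnessed by the semi-standard elements `σ_{p,a} ∗ pairs`
(`p ∈ {2,3,5,7}`). [cite: Aoki1983, Thm. A] -/
def HodgeOctuplesStandard (m : ℕ) : Prop :=
  ∀ s : Multiset (ZMod m), IsHodgeMultiset s → card s = 8 → IsStandard s

/-- **KERNEL — `𝔅⁶ₘ = 𝔇⁶ₘ ⇒ FERMAT-SEPₘ`.** [cell hodge-nonav memo ROUTE-P1AE §B] [cite: Aoki1983, Thm. A] -/
theorem fermatSep_of_hodgeOctuplesStandard [NeZero m] (h : HodgeOctuplesStandard m) : FermatSep m :=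
  fermatSep_of_pairSymmetric_octuples fun s hs h8 ↦ isPairSymmetric_of_isStandard (h s hs h8)

/-- **Aoki 1983 Thm A (ii) at `n = 6`, hypothesis shape** (a NAMED FACT for the Literature, to be typed by the lit
seat; used here only as a hypothesis): if every prime factor of `m` exceeds `8` then `𝔅⁶ₘ = 𝔇⁶ₘ`.
[cite: Aoki1983, Thm. A (ii) (n = 6)] -/
def AokiThmASix (m : ℕ) : Prop :=
  (∀ p : ℕ, p.Prime → p ∣ m → 8 < p) → HodgeOctuplesStandard m

/-- **FERMAT-SEP for every `m` whose prime factors are all `≥ 11`**, given Aoki's Thm A (ii) at `n = 6` as a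
hypothesis. With SQ-AUT + EXO-AUT this is the input half of `HC⁴(X²ₘ × X²ₘ)` for these `m` (PRINT-IMPLIED also by
Shioda 1979 Thm IV + Aoki Thm A). [cite: Aoki1983, Thm. A (ii)] [cite: Shioda1979, Thm. IV] -/
theorem fermatSep_of_aokiThmASix [NeZero m] (hA : AokiThmASix m) (hm : ∀ p : ℕ, p.Prime → p ∣ m → 8 < p) :
    FermatSep m :=
  fermatSep_of_hodgeOctuplesStandard (hA hm)

end Summit.HodgeConjecture.HodgeConjecture.Theorems.FermatSurfaceExoticPairs

end
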